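import Mathlib

/-!
# The Akbulut–Kirby relator is not conjugate to a generator in the braid group `B₃`

Solo residency `solo-SmoothPoincare4-informed`, session 17; kernel certificate behind
PROPOSITION B(a) of the residency file `paper/sharpest-statement.md`, Addendum s17 (a prose
result under adjudication, not a theorem of this tree).

Topological provenance (prose, not formalised here).  For a balanced presentation
`P = ⟨x₁, x₂ | r₁, r₂⟩` of the trivial group, the 5-dimensional thickening `N_P` carries, after
trading its 1-handles for 3-handles, two (2,3)-handle pairs; the first pair always cancels by
Gabai's 4-dimensional light bulb theorem (PROPOSITION A, s16), and the second pair admits a common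
framed dual sphere — the hypothesis of the light bulb theorem — iff `(MC₂)`: `r₂` is conjugate to
`x₂` or `x₂⁻¹` in the one-relator group `⟨x₁, x₂ | r₁⟩`.  For the Akbulut–Kirby presentations
`AK(n) = ⟨x, y | x y x = y x y, xⁿ⁺¹ = yⁿ⟩` the one-relator group is the braid group
`B₃ = ⟨x, y | x y x y⁻¹ x⁻¹ y⁻¹⟩` (the trefoil group) and `(MC₂)` asks whether `xⁿ⁺¹ y⁻ⁿ` is
conjugate in `B₃` to one of `x, x⁻¹, y, y⁻¹`.

What is proved here (pure group theory, kernel-checked): under the representation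
`ρ : B₃ → SL(2, ℤ)`, `x ↦ T = !![1,1;0,1]`, `y ↦ L = !![1,0;-1,1]` (well defined: `T L T = L T L`),
the element `x ^ (n+1) * y ^ (-n)` has trace `n² + n + 2`, while `x, y` and their inverses have
trace `2`; since the trace is a conjugacy invariant, `x ^ (n+1) * y ^ (-n)` is conjugate in `B₃`
to none of `x, x⁻¹, y, y⁻¹` unless `n = 0` or `n = -1` (`akRel_not_isConj_gen`,
`akRel_nat_not_isConj_gen`).  So for every `n ≥ 1` the light-bulb cancellation of the second pair of
`N_{AK(n)}` fails in the natural handle structure, although `N_{AK(n)} ≅ B⁵` is known (Gompf 1991)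
and `AK(1)`, `AK(2)` are Andrews–Curtis trivial: 'light-bulb cancellable in the natural structure'
is strictly finer than both.  Sources: D. Gabai, The 4-dimensional light bulb theorem, J. Amer.
Math. Soc. 33 (2020), arXiv:1705.09989, Thm 1.2; D. Panteleev, A. Ushakov, Conjugacy search problem
and the Andrews–Curtis conjecture, Groups Complex. Cryptol. 11 (2019), arXiv:1609.00325 (ACM-moves);
R. Gompf, Killing the Akbulut–Kirby 4-sphere, Topology 30 (1991).
-/

namespace Summit.SmoothPoincare4.SmoothPoincare4.Theorems
namespace SecondPair

open Matrix Matrix.SpecialLinearGroup ModularGroup MatrixGroups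

/-- The braid relator `x y x y⁻¹ x⁻¹ y⁻¹` on generators `0 ↦ x`, `1 ↦ y`. -/
def braidRel : FreeGroup (Fin 2) :=
  FreeGroup.of 0 * FreeGroup.of 1 * FreeGroup.of 0 *
    (FreeGroup.of 1)⁻¹ * (FreeGroup.of 0)⁻¹ * (FreeGroup.of 1)⁻¹

/-- The relator set of `B₃`. -/
def braidRels : Set (FreeGroup (Fin 2)) := {braidRel}

/-- The three-strand braid group `B₃ = ⟨x, y | x y x = y x y⟩` (= the trefoil knot group). -/
abbrev BraidGroupThree : Type := PresentedGroup braidRels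

/-- The generator `x = σ₁`. -/
def gx : BraidGroupThree := PresentedGroup.of 0
/-- The generator `y = σ₂`. -/
def gy : BraidGroupThree := PresentedGroup.of 1

/-- The Akbulut–Kirby relator `x ^ (n+1) * y ^ (-n)` read in `B₃` (integer parameter). -/
def akRel (n : ℤ) : BraidGroupThree := gx ^ (n + 1) * gy ^ (-n)

/-- The lower unitriangular matrix `L = !![1, 0; -1, 1]` in `SL(2, ℤ)` (image of `σ₂`). -/
def L : SL(2, ℤ) := ⟨!![1, 0; -1, 1], by simp [Matrix.det_fin_two_of]⟩

/-- The underlying matrix of `L`. -/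
theorem coe_L : ↑L = (!![1, 0; -1, 1] : Matrix (Fin 2) (Fin 2) ℤ) := rfl

/-- The underlying matrix of `L⁻¹` is `!![1, 0; 1, 1]`. -/
theorem coe_L_inv : ↑(L⁻¹) = (!![1, 0; 1, 1] : Matrix (Fin 2) (Fin 2) ℤ) := by
  simp [coe_inv, coe_L, adjugate_fin_two]

/-- Powers of `L`: `L ^ k = !![1, 0; -k, 1]`. -/
theorem coe_L_zpow (k : ℤ) : (L ^ k).1 = (!![1, 0; -k, 1] : Matrix (Fin 2) (Fin 2) ℤ) := by
  induction k with
  | zero => simp only [zpow_zero, Matrix.SpecialLinearGroup.coe_one, Matrix.one_fin_two, neg_zero]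
  | succ n h =>
    simp_rw [_root_.zpow_add, zpow_one, coe_mul, h, coe_L, Matrix.mul_fin_two]
    congrm !![?_, ?_; ?_, ?_] <;> ring
  | pred n h =>
    simp_rw [_root_.zpow_sub, zpow_one, coe_mul, h, coe_L_inv, Matrix.mul_fin_two]
    congrm !![?_, ?_; ?_, ?_] <;> ring

/-- The braid relation holds in `SL(2, ℤ)`: `T L T = L T L`. -/
theorem braid_TL : T * L * T = L * T * L := by
  apply Subtype.ext
  simp [coe_mul, coe_T, coe_L]

/-- Images of the generators: `x ↦ T`, `y ↦ L`. -/
def genImg : Fin 2 → SL(2, ℤ) := ![T, L]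

/-- The braid relator maps to `1` under `x ↦ T`, `y ↦ L`. -/
theorem lift_rel : FreeGroup.lift genImg braidRel = 1 := by
  simp only [braidRel, map_mul, map_inv, FreeGroup.lift_apply_of, genImg,
    Matrix.cons_val_zero, Matrix.cons_val_one]
  rw [mul_inv_eq_one, mul_inv_eq_iff_eq_mul, mul_inv_eq_iff_eq_mul]
  exact braid_TL

/-- The representation `ρ : B₃ → SL(2, ℤ)` (the reduced Burau representation at `t = -1`,
up to conventions). -/
def rho : BraidGroupThree →* SL(2, ℤ) :=
  PresentedGroup.toGroup (f := genImg) (by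
    intro r hr
    simp only [braidRels, Set.mem_singleton_iff] at hr
    subst hr
    exact lift_rel)

/-- `ρ(x) = T`. -/
theorem rho_gx : rho gx = T := by simp [rho, gx, genImg]

/-- `ρ(y) = L`. -/
theorem rho_gy : rho gy = L := by simp [rho, gy, genImg]

/-- The trace of an element of `SL(2, ℤ)`. -/
def tr (g : SL(2, ℤ)) : ℤ := Matrix.trace (g : Matrix (Fin 2) (Fin 2) ℤ)

/-- The trace is invariant under conjugation in `SL(2, ℤ)`. -/
theorem tr_conj (c g : SL(2, ℤ)) : tr (c * g * c⁻¹) = tr g := by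
  unfold tr
  have hd : Matrix.det (c : Matrix (Fin 2) (Fin 2) ℤ) = 1 := c.prop
  rw [coe_mul, coe_mul, coe_inv, Matrix.trace_mul_cycle, Matrix.adjugate_mul, hd,
    one_smul, one_mul]

/-- Conjugate elements of `SL(2, ℤ)` have equal traces. -/
theorem tr_eq_of_isConj {g h : SL(2, ℤ)} (hc : IsConj g h) : tr g = tr h := by
  obtain ⟨c, rfl⟩ := isConj_iff.mp hc
  rw [tr_conj]

/-- TRACE OF THE AKBULUT–KIRBY RELATOR: `tr ρ(x ^ (n+1) * y ^ (-n)) = n² + n + 2`. -/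
theorem tr_rho_akRel (n : ℤ) : tr (rho (akRel n)) = n ^ 2 + n + 2 := by
  simp only [akRel, map_mul, map_zpow, rho_gx, rho_gy, tr]
  rw [coe_mul, coe_T_zpow, coe_L_zpow, Matrix.mul_fin_two, Matrix.trace_fin_two_of]
  ring

/-- `tr ρ(x) = 2`. -/
theorem tr_rho_gx : tr (rho gx) = 2 := by
  rw [rho_gx, tr, coe_T, Matrix.trace_fin_two_of]; norm_num

/-- `tr ρ(y) = 2`. -/
theorem tr_rho_gy : tr (rho gy) = 2 := by
  rw [rho_gy, tr, coe_L, Matrix.trace_fin_two_of]; norm_num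

/-- `tr ρ(x⁻¹) = 2`. -/
theorem tr_rho_gx_inv : tr (rho gx⁻¹) = 2 := by
  rw [map_inv, rho_gx, tr, coe_T_inv, Matrix.trace_fin_two_of]; norm_num

/-- `tr ρ(y⁻¹) = 2`. -/
theorem tr_rho_gy_inv : tr (rho gy⁻¹) = 2 := by
  rw [map_inv, rho_gy, tr, coe_L_inv, Matrix.trace_fin_two_of]; norm_num

/-- Every generator and inverse generator of `B₃` has `ρ`-trace `2`. -/
theorem tr_rho_gen {g : BraidGroupThree} (hg : g = gx ∨ g = gy ∨ g = gx⁻¹ ∨ g = gy⁻¹) :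
    tr (rho g) = 2 := by
  rcases hg with rfl | rfl | rfl | rfl
  · exact tr_rho_gx
  · exact tr_rho_gy
  · exact tr_rho_gx_inv
  · exact tr_rho_gy_inv

/-- MAIN STATEMENT (integer form).  For `n ∉ {0, -1}` the Akbulut–Kirby relator
`x ^ (n+1) * y ^ (-n)` is not conjugate in `B₃ = ⟨x, y | x y x = y x y⟩` to any of
`x, y, x⁻¹, y⁻¹`. -/
theorem akRel_not_isConj_gen (n : ℤ) (h0 : n ≠ 0) (h1 : n ≠ -1) {g : BraidGroupThree}
    (hg : g = gx ∨ g = gy ∨ g = gx⁻¹ ∨ g = gy⁻¹) : ¬ IsConj (akRel n) g := by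
  intro hc
  have key := tr_eq_of_isConj (rho.map_isConj hc)
  rw [tr_rho_akRel, tr_rho_gen hg] at key
  have hmul : n * (n + 1) = 0 := by
    have : n ^ 2 + n = 0 := by linarith
    calc n * (n + 1) = n ^ 2 + n := by ring
      _ = 0 := this
  rcases mul_eq_zero.mp hmul with h | h
  · exact h0 h
  · exact h1 (by linarith)

/-- Nor is any generator conjugate to it (symmetric form). -/
theorem gen_not_isConj_akRel (n : ℤ) (h0 : n ≠ 0) (h1 : n ≠ -1) {g : BraidGroupThree}
    (hg : g = gx ∨ g = gy ∨ g = gx⁻¹ ∨ g = gy⁻¹) : ¬ IsConj g (akRel n) :=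
  fun hc => akRel_not_isConj_gen n h0 h1 hg hc.symm

/-- MAIN STATEMENT (the family `AK(n)`, `n ≥ 1`, natural-number form): `x ^ (n+1) * (y ^ n)⁻¹`
is not conjugate in `B₃` to `x`, `y`, `x⁻¹` or `y⁻¹`. -/
theorem akRel_nat_not_isConj_gen (n : ℕ) (hn : 1 ≤ n) {g : BraidGroupThree}
    (hg : g = gx ∨ g = gy ∨ g = gx⁻¹ ∨ g = gy⁻¹) :
    ¬ IsConj (gx ^ (n + 1) * (gy ^ n)⁻¹) g := by
  have h := akRel_not_isConj_gen (n : ℤ) (by exact_mod_cast (by omega : n ≠ 0)) (by omega) hg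
  have e : akRel (n : ℤ) = gx ^ (n + 1) * (gy ^ n)⁻¹ := by
    rw [akRel, _root_.zpow_neg, zpow_natCast,
      show ((n : ℤ) + 1) = ((n + 1 : ℕ) : ℤ) by norm_cast, zpow_natCast]
  rwa [e] at h

/-- In particular (the case used for the smallest potential Andrews–Curtis counterexample `AK(3)`):
`x ^ 4 * (y ^ 3)⁻¹` is not conjugate to `y` in `B₃`. -/
theorem ak3Rel_not_isConj_gy : ¬ IsConj (gx ^ 4 * (gy ^ 3)⁻¹) gy :=
  akRel_nat_not_isConj_gen 3 (by norm_num) (Or.inr (Or.inl rfl))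

end SecondPair
end Summit.SmoothPoincare4.SmoothPoincare4.Theorems
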